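import Mathlib
import Literature.RingTheory.Etale.UnramifiedRadicialSurjective
import Literature.RingTheory.PBasis.PBasisDerivations
import Literature.RingTheory.Derivation.SliceDecomposition
import HarnessLib

/-!
# Étale coordinates give a `p`-basis: `R` étale over `κ[X_σ]` (`κ` perfect, `char κ = p`) has `p`-basis `(Xᵢ)` over `R^p`,
# and `dx = 0 ⇒ x ∈ R^p`

Topic: `Literature/RingTheory/PBasis` (sequel of `KimuraNiitsuma1980` / `PBasisDerivations`: the notion `IsPBasisOver p R′ Γ`).
Let `κ` be a perfect field of characteristic `p`, `P = κ[X_σ]` a polynomial ring and `R` an ÉTALE `P`-algebra (more generally: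
formally unramified of finite type for the generation half, plus formally étale for the independence half), `tᵢ ∈ R` the images of
the variables.  Then:

* (generation) `R = R^p[tᵢ : i ∈ σ]` — the relative Frobenius of an unramified algebra is surjective
  (`Literature.RingTheory.Etale.adjoin_range_frobenius_eq_top`) and `κ = κ^p ⊆ R^p`;
* (dual derivations) `Ω[R⁄κ] ≅ R ⊗_P Ω[P⁄κ]` is free on the `dtᵢ` (Mathlib `KaehlerDifferential.tensorKaehlerEquivOfFormallyEtale`,
  `mvPolynomialBasis`), whose dual basis gives `κ`-derivations `dsᵢ` of `R` with `dsᵢ tⱼ = δᵢⱼ`, each factoring through `d : R → Ω[R⁄κ]`;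
* (independence — the ENGINE, any coefficient ring) a REDUCED polynomial relation `G(b) = 0` (exponents `< p`) over a subring
  admitting dual derivations is trivial (`eq_zero_of_reduced_of_aeval_eq_zero`: induct on the total degree, differentiating along a
  variable of a top monomial — the chain rule `dsᵢ(G(b)) = (dsG/dsXᵢ)(b)` and `0 < dᵢ < p` a unit);
* hence **`isPBasisOver_frobenius_range_coordinates`: `IsPBasisOver p R^p {tᵢ}`** — the `tᵢ` form a `p`-basis of `R` over `R^p`
  ([KimuraNiitsuma1980] p. 363; [Matsumura1987] §26, Thm. 26.6/26.8 for fields: a separating transcendence basis is a `p`-basis;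
  here the ring version for étale coordinates), so all of `PBasisDerivations` (presentation `R ≅ R^p[X]/(X^p − t^p)`, unique
  extension of derivations) applies to smooth-local charts;
* and **`exists_pow_eq_of_kaehlerDifferential_D_eq_zero_of_etale`: `d x = 0` in `Ω[R⁄κ]` ⇒ `x = y^p`** (Cartier, step 0: the kernel of
  `d` on an étale-coordinate chart is exactly the `p`-th powers; [Katz1970Nilpotent] Thm. 7.2, [Illusie1979] 0.(2.1.9)) — expand
  `x` in the `p`-basis, differentiate termwise (`ds_γ G = 0` for all `γ`), conclude `G` is constant.

No reducedness, noetherianity or finiteness of `σ` is needed (for `σ : Type`; `κ, R : Type u`).  Theorems only; no definitions.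

References: [KimuraNiitsuma1980] p. 363; [Matsumura1987] §26 (p-bases, Thm. 26.5–26.8), §30 Thm. 30.5; [Katz1970Nilpotent] Thm. 7.2;
[GortzWedhorn2023] Exercise 18.25.  Cell hodgecm-mathlib (E2 background «étale leg»; generic leaf, no floor change; HC_CM is proved
only modulo the 7 printed citations until rung 0 closes).
-/

noncomputable section

namespace Literature.RingTheory.PBasis

open MvPolynomial

universe u
/-! ### §1. The engine: reduced polynomial relations over dual derivations are trivial (any coefficient ring) -/
section Engine
variable {S A : Type*} [CommRing S] [CommRing A] [Algebra S A] {σ : Type*}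

/-- **Chain rule along a dual derivation.**  If an `S`-derivation `δ` of `A` is dual to the coordinate `i` of a family
`b : σ → A` (`δ (b i) = 1`, `δ (b j) = 0` for `j ≠ i`), then `δ (G(b)) = (dsG/dsX_i)(b)` for every polynomial `G` with
coefficients in `S`. [cite: Matsumura1987, §26 p. 202 (before Thm 26.5)] -/
theorem derivation_aeval_eq_aeval_pderiv (b : σ → A) (i : σ) (δ : Derivation S A A)
    (h1 : δ (b i) = 1) (h0 : ∀ j, j ≠ i → δ (b j) = 0) (G : MvPolynomial σ S) :
    δ (aeval b G) = aeval b (pderiv i G) := by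
  classical
  induction G using MvPolynomial.induction_on with
  | C c =>
    rw [aeval_C, Derivation.map_algebraMap, pderiv_C, map_zero]
  | add f g hf hg => rw [map_add, map_add, map_add, map_add, hf, hg]
  | mul_X f j hf =>
    rw [map_mul, aeval_X, Derivation.leibniz, Derivation.leibniz, map_add, hf]
    by_cases hij : j = i
    · subst hij
      rw [h1, pderiv_X_self]
      simp only [smul_eq_mul, mul_one, map_mul, aeval_X]
    · rw [h0 j hij, pderiv_X_of_ne hij]
      simp only [smul_eq_mul, map_mul, aeval_X, map_zero]

/-- In characteristic `p`, a natural number `0 < n < p` is a unit (the factorials `n!`, `n < p`, are units; Matsumura §25 Ex. 25.5).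
[cite: Matsumura1987, §25 Exercise 25.5] -/
theorem isUnit_natCast_of_pos_of_lt (p : ℕ) [Fact p.Prime] [CharP A p] {n : ℕ} (h0 : 0 < n) (hn : n < p) :
    IsUnit ((n : ℕ) : A) := by
  have h := Literature.RingTheory.Derivation.isUnit_cast_factorial_of_lt (A := A) p hn
  obtain ⟨m, rfl⟩ := Nat.exists_eq_succ_of_ne_zero h0.ne'
  rw [Nat.factorial_succ, Nat.cast_mul] at h
  exact isUnit_of_mul_isUnit_left h

/-- The degree `|s| = Σ s_j` of an exponent vector dominates each exponent. [folklore] -/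
private theorem apply_le_sum (s : σ →₀ ℕ) (i : σ) : s i ≤ s.sum fun _ e => e := by
  classical
  by_cases hi : s i = 0
  · rw [hi]; exact Nat.zero_le _
  · exact Finset.single_le_sum (f := fun j => s j) (fun j _ => Nat.zero_le _) (Finsupp.mem_support_iff.mpr hi)

/-- `|m + e_i| = |m| + 1`. [folklore] -/
private theorem sum_add_single_one (m : σ →₀ ℕ) (i : σ) :
    ((m + Finsupp.single i 1).sum fun _ e => e) = (m.sum fun _ e => e) + 1 := by
  rw [Finsupp.sum_add_index' (fun _ => rfl) (fun _ _ _ => rfl), Finsupp.sum_single_index rfl]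

/-- **The engine: a REDUCED polynomial relation over dual derivations is trivial.**  Let `S → A` be injective, `A` of
characteristic `p`, `b : σ → A` a family admitting dual `S`-derivations `δ i` (`δ i (b i) = 1`, `δ i (b j) = 0` for
`j ≠ i`).  If `G ∈ S[X_σ]` has all exponents `< p` and `G(b) = 0`, then `G = 0` (induction on the total degree: `dsG/dsX_i` is
again reduced, vanishes at `b` by the chain rule, and its top coefficients are `d_i · c_d` with `0 < d_i < p` a unit).  This
is the linear independence of the reduced monomials of a `p`-basis (Matsumura §26: the reduced monomials «are linearly
independent over `K^p(k)`»). [cite: Matsumura1987, §26 p. 202 (before Thm 26.5)] -/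
theorem eq_zero_of_reduced_of_aeval_eq_zero (p : ℕ) [Fact p.Prime] [CharP A p]
    (hinj : Function.Injective (algebraMap S A)) (b : σ → A) (δ : σ → Derivation S A A)
    (hδ₁ : ∀ i, δ i (b i) = 1) (hδ₀ : ∀ i j, j ≠ i → δ i (b j) = 0) (G : MvPolynomial σ S)
    (hred : ∀ d ∈ G.support, ∀ i, d i < p) (h0 : aeval b G = 0) : G = 0 := by
  classical
  haveI : CharP S p := (algebraMap S A).charP hinj p
  induction hn : G.totalDegree using Nat.strong_induction_on generalizing G with
  | _ n ih =>
    by_contra hG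
    have hsupp : G.support.Nonempty := MvPolynomial.support_nonempty.mpr hG
    obtain ⟨d, hd, hdsum⟩ :=
      Finset.exists_mem_eq_sup G.support hsupp (fun s : σ →₀ ℕ => s.sum fun _ e => e)
    have hdeg : G.totalDegree = d.sum fun _ e => e := hdsum
    by_cases hd0 : d = 0
    · -- total degree `0`: `G` is a constant, killed by the injective `algebraMap`
      have htot : G.totalDegree = 0 := by rw [hdeg, hd0, Finsupp.sum_zero_index]
      have hc : G = C (G.coeff 0) := totalDegree_eq_zero_iff_eq_C.mp htot
      rw [hc, aeval_C] at h0
      have hc0 : G.coeff 0 = 0 := hinj (by rw [h0, map_zero])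
      exact hG (by rw [hc, hc0, C_0])
    · -- positive degree: differentiate along a variable occurring in the top monomial `d`
      obtain ⟨i, hi'⟩ := Finsupp.support_nonempty_iff.mpr hd0
      have hi : d i ≠ 0 := Finsupp.mem_support_iff.mp hi'
      set G' := pderiv i G with hG'
      have hmem : ∀ m ∈ G'.support, m + Finsupp.single i 1 ∈ G.support := by
        intro m hm
        have hcoeff : coeff m G' ≠ 0 := mem_support_iff.mp hm
        rw [hG', coeff_pderiv] at hcoeff
        rw [mem_support_iff]
        intro h
        exact hcoeff (by rw [h, zero_mul])
      have hred' : ∀ m ∈ G'.support, ∀ j, m j < p := by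
        intro m hm j
        refine lt_of_le_of_lt ?_ (hred _ (hmem m hm) j)
        simp only [Finsupp.add_apply]
        exact Nat.le_add_right _ _
      have h0' : aeval b G' = 0 := by
        rw [hG', ← derivation_aeval_eq_aeval_pderiv b i (δ i) (hδ₁ i) (hδ₀ i), h0, map_zero]
      have hdpos : 0 < d.sum fun _ e => e := lt_of_lt_of_le (Nat.pos_of_ne_zero hi) (apply_le_sum d i)
      have hlt : G'.totalDegree < n := by
        rw [← hn, hdeg]
        refine lt_of_le_of_lt (Finset.sup_le fun m hm => ?_) (Nat.sub_one_lt_of_le hdpos le_rfl)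
        have hle := Finset.le_sup (f := fun s : σ →₀ ℕ => s.sum fun _ e => e) (hmem m hm)
        rw [hdsum] at hle
        change ((m + Finsupp.single i 1).sum fun _ e => e) ≤ d.sum fun _ e => e at hle
        rw [sum_add_single_one] at hle
        change (m.sum fun _ e => e) ≤ (d.sum fun _ e => e) - 1
        omega
      have hG'0 : G' = 0 := ih _ hlt G' hred' h0' rfl
      have hle1 : Finsupp.single i 1 ≤ d := Finsupp.single_le_iff.mpr (Nat.one_le_iff_ne_zero.mpr hi)
      have hcoeff : coeff (d - Finsupp.single i 1) G' = 0 := by rw [hG'0, coeff_zero]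
      rw [hG', coeff_pderiv, tsub_add_cancel_of_le hle1] at hcoeff
      have hdi : ((d - Finsupp.single i 1 : σ →₀ ℕ) i : ℕ) + 1 = d i := by
        rw [Finsupp.tsub_apply, Finsupp.single_eq_same]
        omega
      rw [← Nat.cast_add_one, hdi] at hcoeff
      have hunit : IsUnit ((d i : ℕ) : S) :=
        isUnit_natCast_of_pos_of_lt (A := S) p (Nat.pos_of_ne_zero hi) (hred d hd i)
      exact (mem_support_iff.mp hd) (hunit.mul_left_eq_zero.mp hcoeff)

/-- A reduced polynomial all of whose partial derivatives vanish is a constant (characteristic `p`): the coefficient of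
`X^(d - e_i)` in `dsG/dsX_i` is `d_i · c_d` with `0 < d_i < p` a unit. [cite: Matsumura1987, §26 p. 202 (before Thm 26.5)] -/
theorem eq_C_of_reduced_of_forall_pderiv_eq_zero (p : ℕ) [Fact p.Prime] [CharP S p] (G : MvPolynomial σ S)
    (hred : ∀ d ∈ G.support, ∀ i, d i < p) (h : ∀ i, pderiv i G = 0) : G = C (G.coeff 0) := by
  classical
  ext d
  rw [coeff_C]
  by_cases hd0 : (0 : σ →₀ ℕ) = d
  · rw [if_pos hd0, hd0]
  · rw [if_neg hd0]
    by_contra hne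
    have hd : d ∈ G.support := mem_support_iff.mpr hne
    obtain ⟨i, hi'⟩ := Finsupp.support_nonempty_iff.mpr (Ne.symm hd0)
    have hi : d i ≠ 0 := Finsupp.mem_support_iff.mp hi'
    have hle1 : Finsupp.single i 1 ≤ d := Finsupp.single_le_iff.mpr (Nat.one_le_iff_ne_zero.mpr hi)
    have hcoeff : coeff (d - Finsupp.single i 1) (pderiv i G) = 0 := by rw [h i, coeff_zero]
    rw [coeff_pderiv, tsub_add_cancel_of_le hle1] at hcoeff
    have hdi : ((d - Finsupp.single i 1 : σ →₀ ℕ) i : ℕ) + 1 = d i := by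
      rw [Finsupp.tsub_apply, Finsupp.single_eq_same]
      omega
    rw [← Nat.cast_add_one, hdi] at hcoeff
    have hunit : IsUnit ((d i : ℕ) : S) :=
      isUnit_natCast_of_pos_of_lt (A := S) p (Nat.pos_of_ne_zero hi) (hred d hd i)
    exact hne (hunit.mul_left_eq_zero.mp hcoeff)

/-- **A derivation of a ring of characteristic `p` is linear over the subring `R^p` of `p`-th powers** (`D(y^p) =
p·y^{p-1}·D y = 0`): every `κ`-derivation `ds : A → A` is (the underlying map of) an `A^p`-derivation.  Used to run the engine
over the coefficient ring `A^p = range (frobenius A p)`. [cite: Matsumura1987, §25 (derivations kill `p`-th powers)] -/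
theorem exists_derivation_frobenius_range_eq {κ : Type*} [CommRing κ] [Algebra κ A] (p : ℕ) [Fact p.Prime] [CharP A p]
    (D : Derivation κ A A) : ∃ δ : Derivation (frobenius A p).range A A, ∀ a, δ a = D a := by
  have hp : p.Prime := Fact.out
  have hkill : ∀ c : (frobenius A p).range, D (c : A) = 0 := by
    rintro ⟨_, y, rfl⟩
    change D (frobenius A p y) = 0
    rw [frobenius_def, Derivation.leibniz_pow, nsmul_eq_mul, CharP.cast_eq_zero, zero_mul]
  refine ⟨{ toFun := D
            map_add' := fun a b => map_add D a b
            map_smul' := fun c a => ?_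
            map_one_eq_zero' := D.map_one_eq_zero
            leibniz' := fun a b => D.leibniz a b }, fun a => rfl⟩
  change D ((c : A) * a) = (c : A) * D a
  rw [Derivation.leibniz, hkill c, smul_zero, add_zero, smul_eq_mul]

end Engine
/-! ### §2. Étale coordinates: dual derivations, generation over `R^p`, the `p`-basis, and the kernel of `d` -/
section Etale
variable (p : ℕ) [Fact p.Prime] {κ : Type u} [Field κ] {σ : Type}
variable (R : Type u) [CommRing R] [Algebra (MvPolynomial σ κ) R] [Algebra κ R] [IsScalarTower κ (MvPolynomial σ κ) R]

/-- **Dual derivations from étale coordinates.**  For `R` formally étale over `P = κ[X_σ]`, `Ω[R⁄κ]` is free on the `d tᵢ`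
(`tᵢ` = image of `Xᵢ`; Mathlib `KaehlerDifferential.tensorKaehlerEquivOfFormallyEtale` + `mvPolynomialBasis`), and the dual basis
gives `κ`-derivations `dsᵢ` of `R` with `dsᵢ tᵢ = 1`, `dsᵢ tⱼ = 0` (`j ≠ i`), each FACTORING THROUGH `d` (so `d x = 0 ⇒ dsᵢ x = 0`).
[cite: Matsumura1987, §26 Thm. 26.5 and p. 202; §25 Thm. 25.1] -/
theorem exists_dual_derivations_of_formallyEtale [Algebra.FormallyEtale (MvPolynomial σ κ) R] :
    ∃ ds : σ → Derivation κ R R,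
      (∀ i, ds i (algebraMap (MvPolynomial σ κ) R (X i)) = 1) ∧
      (∀ i j, j ≠ i → ds i (algebraMap (MvPolynomial σ κ) R (X j)) = 0) ∧
      ∀ i x, KaehlerDifferential.D κ R x = 0 → ds i x = 0 := by
  classical
  let E := KaehlerDifferential.tensorKaehlerEquivOfFormallyEtale κ (MvPolynomial σ κ) R
  let B : Module.Basis σ R (Ω[R⁄κ]) :=
    (Algebra.TensorProduct.basis R (KaehlerDifferential.mvPolynomialBasis κ σ)).map E
  have hB : ∀ i, B i = KaehlerDifferential.D κ R (algebraMap (MvPolynomial σ κ) R (X i)) := by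
    intro i
    change E (Algebra.TensorProduct.basis R (KaehlerDifferential.mvPolynomialBasis κ σ) i) = _
    rw [Algebra.TensorProduct.basis_apply, KaehlerDifferential.mvPolynomialBasis_apply,
      ← KaehlerDifferential.tensorKaehlerEquivOfFormallyEtale_symm_D_algebraMap, LinearEquiv.apply_symm_apply]
  refine ⟨fun i => (B.coord i).compDer (KaehlerDifferential.D κ R), fun i => ?_, fun i j hj => ?_, fun i x hx => ?_⟩
  · change B.coord i (KaehlerDifferential.D κ R _) = 1
    rw [← hB, Module.Basis.coord_apply, Module.Basis.repr_self, Finsupp.single_eq_same]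
  · change B.coord i (KaehlerDifferential.D κ R _) = 0
    rw [← hB, Module.Basis.coord_apply, Module.Basis.repr_self, Finsupp.single_apply, if_neg hj]
  · change B.coord i (KaehlerDifferential.D κ R x) = 0
    rw [hx, map_zero]

/-- **Generation: `R = R^p[tᵢ]`.**  For `R` of finite type and formally unramified over `P = κ[X_σ]` with `κ` perfect of
characteristic `p`, the subring `R^p` of `p`-th powers together with the coordinates `tᵢ` generates `R`: `R` is generated
over `P` by `R^p` (surjectivity of the relative Frobenius, `Literature.RingTheory.Etale.adjoin_range_frobenius_eq_top`) and the
image of `P = κ[X]` lies in `R^p[t]` because `κ = κ^p`. [cite: GortzWedhorn2023, Exercise 18.25 (4)]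
[cite: KimuraNiitsuma1980, p. 363 l. 7–10] -/
theorem adjoin_frobenius_range_coordinates_eq_top [CharP R p] [PerfectRing κ p]
    [Algebra.FiniteType (MvPolynomial σ κ) R] [Algebra.FormallyUnramified (MvPolynomial σ κ) R] :
    Algebra.adjoin (frobenius R p).range (Set.range fun i : σ => algebraMap (MvPolynomial σ κ) R (X i)) = ⊤ := by
  set Rp : Subring R := (frobenius R p).range with hRp
  set T : Subalgebra Rp R := Algebra.adjoin Rp (Set.range fun i : σ => algebraMap (MvPolynomial σ κ) R (X i)) with hT
  -- the image of `P = κ[X_σ]` lies in `R^p[t]`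
  have hP : ∀ f : MvPolynomial σ κ, algebraMap (MvPolynomial σ κ) R f ∈ T := by
    intro f
    induction f using MvPolynomial.induction_on with
    | C c =>
      obtain ⟨c', hc'⟩ := (PerfectRing.bijective_frobenius (R := κ) (p := p)).2 c
      have hc : c' ^ p = c := hc'
      have : algebraMap (MvPolynomial σ κ) R (C c) = algebraMap κ R c' ^ p := by
        rw [← map_pow, hc, IsScalarTower.algebraMap_apply κ (MvPolynomial σ κ) R, MvPolynomial.algebraMap_eq]
      rw [this]
      exact T.range_le ⟨⟨_, algebraMap κ R c', rfl⟩, rfl⟩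
    | add f g hf hg => rw [map_add]; exact add_mem hf hg
    | mul_X f i hf =>
      rw [map_mul]
      exact mul_mem hf (Algebra.subset_adjoin ⟨i, rfl⟩)
  -- `R` is generated over `P` by `R^p`
  have hgen := Literature.RingTheory.Etale.adjoin_range_frobenius_eq_top (P := MvPolynomial σ κ) (R := R) p
  rw [eq_top_iff]
  intro r _
  have hr : r ∈ Algebra.adjoin (MvPolynomial σ κ) (Set.range (frobenius R p)) := by rw [hgen]; exact Algebra.mem_top
  refine Algebra.adjoin_induction (fun x hx => ?_) (fun f => hP f) (fun _ _ _ _ hx hy => add_mem hx hy)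
    (fun _ _ _ _ hx hy => mul_mem hx hy) hr
  obtain ⟨y, rfl⟩ := hx
  exact T.range_le ⟨⟨frobenius R p y, y, rfl⟩, rfl⟩

/-- **Étale coordinates form a `p`-basis over `R^p`** (`κ` perfect of characteristic `p`, `R` étale over `κ[X_σ]`): the images
`tᵢ` of the variables satisfy `IsPBasisOver p R^p {tᵢ}` — `R^p[t] = R` (generation) and the reduced monomials in finitely many
distinct `tᵢ` are `R^p`-linearly independent (the engine, run with the dual derivations). Ring version, for étale coordinates, of
«a separating transcendence basis of a separably generated extension is a `p`-basis» ([Matsumura1987] Thm. 26.8 / 26.6).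
[cite: KimuraNiitsuma1980, p. 363 l. 7–10] [cite: Matsumura1987, §26 Thm. 26.6–26.8] -/
theorem isPBasisOver_frobenius_range_coordinates [CharP R p] [PerfectRing κ p] [Algebra.Etale (MvPolynomial σ κ) R] :
    IsPBasisOver p (frobenius R p).range (Set.range fun i : σ => algebraMap (MvPolynomial σ κ) R (X i)) := by
  classical
  set t : σ → R := fun i => algebraMap (MvPolynomial σ κ) R (X i) with ht
  refine ⟨adjoin_frobenius_range_coordinates_eq_top p R, fun s b hb hbt => ?_⟩
  -- coordinates indices of the `b i`
  choose e he using fun i => hbt i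
  have he_inj : ∀ i j, e j = e i → j = i := fun i j h => hb (by rw [← he i, ← he j, h])
  -- dual derivations, made `R^p`-linear
  obtain ⟨ds, hds₁, hds₀, -⟩ := exists_dual_derivations_of_formallyEtale (κ := κ) (σ := σ) R
  choose δ hδ using fun i => exists_derivation_frobenius_range_eq (A := R) p (ds (e i))
  have hδ₁ : ∀ i, δ i (b i) = 1 := fun i => by rw [hδ, ← he i]; exact hds₁ (e i)
  have hδ₀ : ∀ i j, j ≠ i → δ i (b j) = 0 := fun i j hij => by
    rw [hδ, ← he j]
    exact hds₀ (e i) (e j) fun h => hij (he_inj i j h)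
  -- a vanishing `R^p`-combination of reduced monomials is a reduced polynomial relation
  rw [Fintype.linearIndependent_iff]
  intro g hg n
  let fe : (Fin s → Fin p) → (Fin s →₀ ℕ) := fun m => Finsupp.equivFunOnFinite.symm fun i => (m i : ℕ)
  have hfe : ∀ m i, fe m i = (m i : ℕ) := fun m i => rfl
  have hfe_inj : Function.Injective fe := by
    intro m m' h
    funext i
    exact Fin.ext (by rw [← hfe m i, ← hfe m' i, h])
  set G : MvPolynomial (Fin s) (frobenius R p).range := ∑ m, monomial (fe m) (g m) with hG
  have hcoeffG : ∀ m, G.coeff (fe m) = g m := by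
    intro m
    rw [hG, coeff_sum]
    simp_rw [coeff_monomial]
    rw [Finset.sum_eq_single m (fun m' _ hm' => if_neg fun h => hm' (hfe_inj h)) (fun h => (h (Finset.mem_univ m)).elim),
      if_pos rfl]
  have hsuppG : ∀ d ∈ G.support, ∃ m, d = fe m := by
    intro d hd
    rw [hG] at hd
    obtain ⟨m, -, hm⟩ := Finset.mem_biUnion.mp (support_sum hd)
    rw [support_monomial] at hm
    split_ifs at hm with h
    · exact absurd hm (Finset.notMem_empty d)
    · exact ⟨m, Finset.mem_singleton.mp hm⟩
  have hred : ∀ d ∈ G.support, ∀ i, d i < p := by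
    intro d hd i
    obtain ⟨m, rfl⟩ := hsuppG d hd
    rw [hfe]
    exact (m i).isLt
  have haeval : aeval b G = ∑ m, g m • ∏ i, b i ^ (m i : ℕ) := by
    rw [hG, map_sum]
    refine Finset.sum_congr rfl fun m _ => ?_
    rw [aeval_monomial, Finsupp.prod_fintype _ _ fun i => pow_zero (b i), Algebra.smul_def]
    rfl
  have hG0 : G = 0 :=
    eq_zero_of_reduced_of_aeval_eq_zero p Subtype.val_injective b δ hδ₁ hδ₀ G hred (haeval.trans hg)
  have := hcoeffG n
  rw [hG0, coeff_zero] at this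
  exact this.symm

omit [Fact p.Prime] in
/-- The relations `X_γ^p − γ^p` of the presentation of `PBasisDerivations` evaluate to `0` (bookkeeping). [cite: Matsumura1987, §26 p. 202] -/
private theorem relations_le_ker {R' : Subring R} (hR' : ∀ x : R, x ^ p ∈ R') (Γ : Set R) :
    Ideal.span (Set.range fun γ : Γ => (X γ ^ p - C ⟨((γ : Γ) : R) ^ p, hR' _⟩ : MvPolynomial Γ R')) ≤
      RingHom.ker (aeval ((↑) : Γ → R) : MvPolynomial Γ R' →ₐ[R'] R) := by
  rw [Ideal.span_le]
  rintro _ ⟨γ, rfl⟩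
  rw [SetLike.mem_coe, RingHom.mem_ker]
  change aeval ((↑) : Γ → R) (X γ ^ p - C (⟨((γ : Γ) : R) ^ p, hR' _⟩ : R')) = 0
  rw [map_sub, map_pow, aeval_X, aeval_C]
  exact sub_self _

/-- **Cartier, step 0, on an étale-coordinate chart: `d x = 0 ⇒ x` is a `p`-th power.**  For `R` étale over `κ[X_σ]`, `κ`
perfect of characteristic `p`, an element of `R` whose Kähler differential in `Ω[R⁄κ]` vanishes lies in `R^p`: expand `x = G(t)`
along the `p`-basis with `G` reduced over `R^p`; every dual derivation kills `x`, so `(dsG/dsX_γ)(t) = 0`, hence `dsG/dsX_γ = 0`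
(engine), hence `G` is constant.  No reducedness hypothesis. [cite: Katz1970Nilpotent, Thm. 7.2 (Cartier isomorphism, degree 0)]
[cite: Matsumura1987, §26 Thm. 26.5] -/
theorem exists_pow_eq_of_kaehlerDifferential_D_eq_zero_of_etale [CharP R p] [PerfectRing κ p] [Algebra.Etale (MvPolynomial σ κ) R]
    (x : R)
    (hx : KaehlerDifferential.D κ R x = 0) : ∃ y : R, y ^ p = x := by
  classical
  set Rp : Subring R := (frobenius R p).range with hRp
  haveI : CharP Rp p := (Subring.subtype Rp).charP Subtype.val_injective p
  have hpow : ∀ z : R, z ^ p ∈ Rp := fun z => ⟨z, frobenius_def ..⟩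
  set Γ : Set R := Set.range fun i : σ => algebraMap (MvPolynomial σ κ) R (X i) with hΓ
  have h := isPBasisOver_frobenius_range_coordinates (κ := κ) (σ := σ) p R
  -- expand `x` along the `p`-basis with a reduced polynomial `G`
  obtain ⟨F, hF⟩ := IsPBasisOver.aeval_val_surjective h x
  obtain ⟨G, hGred, hFG⟩ := IsPBasisOver.exists_reduced_sub_mem_relations (R' := Rp) (Γ := Γ) hpow F
  have hGx : aeval ((↑) : Γ → R) G = x := by
    have h0 : aeval ((↑) : Γ → R) (F - G) = 0 := relations_le_ker p R hpow Γ hFG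
    rw [map_sub, hF, sub_eq_zero] at h0
    exact h0.symm
  -- dual derivations indexed by `Γ`, `R^p`-linear
  obtain ⟨ds, hds₁, hds₀, hdsD⟩ := exists_dual_derivations_of_formallyEtale (κ := κ) (σ := σ) R
  choose ι hι using fun γ : Γ => (Set.mem_range.mp γ.2)
  have hιinj : ∀ γ γ' : Γ, ι γ = ι γ' → γ = γ' := fun γ γ' hγ => Subtype.ext (by rw [← hι γ, ← hι γ', hγ])
  choose δ hδ using fun γ : Γ => exists_derivation_frobenius_range_eq (A := R) p (ds (ι γ))
  have hδ₁ : ∀ γ : Γ, δ γ (γ : R) = 1 := fun γ => by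
    rw [hδ]
    conv_lhs => rw [← hι γ]
    exact hds₁ (ι γ)
  have hδ₀ : ∀ γ γ' : Γ, γ' ≠ γ → δ γ (γ' : R) = 0 := fun γ γ' hne => by
    rw [hδ]
    conv_lhs => rw [← hι γ']
    exact hds₀ (ι γ) (ι γ') fun h' => hne (hιinj γ' γ h')
  -- every partial derivative of `G` vanishes
  have hpd : ∀ γ : Γ, pderiv γ G = 0 := by
    intro γ
    have hredγ : ∀ d ∈ (pderiv γ G).support, ∀ γ', d γ' < p := by
      intro d hd γ'
      have hcoeff : coeff d (pderiv γ G) ≠ 0 := mem_support_iff.mp hd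
      rw [coeff_pderiv] at hcoeff
      have hmem : d + Finsupp.single γ 1 ∈ G.support := by
        rw [mem_support_iff]
        intro h0
        exact hcoeff (by rw [h0, zero_mul])
      refine lt_of_le_of_lt ?_ (hGred _ hmem γ')
      simp only [Finsupp.add_apply]
      exact Nat.le_add_right _ _
    have h0 : aeval ((↑) : Γ → R) (pderiv γ G) = 0 := by
      rw [← derivation_aeval_eq_aeval_pderiv ((↑) : Γ → R) γ (δ γ) (hδ₁ γ) (fun γ' h' => hδ₀ γ γ' h') G, hGx,
        hδ, hdsD (ι γ) x hx]
    exact eq_zero_of_reduced_of_aeval_eq_zero p Subtype.val_injective ((↑) : Γ → R) δ hδ₁ hδ₀ _ hredγ h0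
  -- hence `G` is a constant `c ∈ R^p`, and `x = c`
  have hGC : G = C (G.coeff 0) := eq_C_of_reduced_of_forall_pderiv_eq_zero p G hGred hpd
  obtain ⟨y, hy⟩ := (G.coeff 0).2
  refine ⟨y, ?_⟩
  rw [← hGx, hGC, aeval_C]
  exact hy

end Etale

end Literature.RingTheory.PBasis
end
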